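import Summits.QuantumFields.BalabanUV.Beta.GAN24.T2RecHybridSplit
import Summits.QuantumFields.BalabanUV.Beta.GAN24.TransportRows

/-!
# `BalabanUV.Beta.GAN24.T2HybridShapeEnd` — binder row G-an2-4 ∕ (CONV-C), CT-W (RULING R-gan24p1-g22-1 «HYB-END», AMENDED by R-gan24p1-g23-1):
# **(F5) member 0 of the comb T₂ tower, and the `d = 3` HYBRID-SPLIT SOCKET — road W3's END #1 at a hybrid carrier with ABSTRACT sources and remainder**
# (row owner b2b-balaban-gan24-p1, gen 23)

NOT IN PRINT; OUR PROOF ATTEMPT.  HONEST FRAMING (cell contract, verbatim): «discharging `BetaPertH` makes Bałaban's UV stability UNCONDITIONAL — a real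
constructive-QFT result; it is NOT the continuum limit and NOT the Clay problem.»  HONEST DEPENDENCY (verbatim): «continuum YM on T⁴ ⇐ BetaPertH ∧ nine spine
estimates (0/9 proved); BetaPertH ⇐ (D1) ∧ (D4) ∧ CAP+tail; G-an2-4 gates asym, D1 and NE2/3/4.»

WHAT ([folklore] bookkeeping; 0 `def`, 0 cited facts, 0 `def … : Prop`, 0 sorry).
* §1 `locStencil₂_unitS₂_T2RecAt_zero` — (F5) member 0 of an2's comb tower (`unitS₂_0 = id` by `unitS₂_step_zero`; `T2RecAt … 0 = cE₂ • wilsonW₂ d Tc + cB • vh₂S` by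
  `T2RecAt_zero_level`; an3's `biLoc_wilsonW₂` and the border's own `LocStencil₂` row): a `LocStencil₂` family at every rate below the border's — generic `d`, any root,
  any `cE cVH cΛ`, any mixed table.
* §2 **`shape_three_of_hyb_rows`** — THE `d = 3` HYBRID-SPLIT SOCKET with the sources `b` and the remainder `CT` ABSTRACT: if `T n = (𝒯^B(0,n) (T 0) + Σ_{i<n}
  𝒯^B(i+1,n−1−i) (b i)) + CT n` for road W3's UNDRESSED transport of record `𝒯^B = transport (j ↦ lin4 (cE₂·Lc^8) (unitK_j (KInvStep Lc j)) Lc)`, the K-slot holds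
  (`UnitDecayK`, rate `mK > 0`), `|cE₂| ≤ Lc^8`, the sources are uniformly `LocStencil₂` and `ZfreeSym` (joint `Lc`-covariance ∧ vanishing bond-symmetrised ff cell charge
  `zmode` — the currency of leaf-10∕leaf-12's `TransportRows.transport_rows_three_symZ`, used here with `mom := 0`), member 0 is `LocStencil₂` and `CT` is uniformly
  `LocStencil₂`, then `∃ C₂ δ₂, 0 < δ₂ ∧ ∀ n, LocStencil₂ (T n) C₂ δ₂` — my `WSlotT2OfPieces.shape_of_rows (d := 3)` (gen 5) at the hybrid carrier with p2 g35's
  `T2RecHybridSplit.hyb_hsplit` (definitional), plus `locStencil₂_add` for `CT`; the four input rates merged by `min`.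
WHICH SOURCES (ruling R-gan24p1-g23-1, `HOME/b2b-balaban-gan24-p1/gen23/F2-NUMERIC-v0.md`): the (R-HYB) instantiation of CT-W-DESIGN-v0 (`b :=` the T-FREE dressed
sources `b̃_i` of p2's `unitS₂_T2RecAt_eq_hyb_add_contact`, `CT :=` the contact remainder) is NOT typed here — the owner's numeric twin of the (F2) first test (D = 2)
gives `zmode (b̃_0) = −8·zmode (𝒜^B_0 T_0) ≠ 0`, i.e. its `hZ` would be unsatisfiable at `m = 0`; the socket serves instead (R-HYB′) — `b := b′_i := T̃_{i+1} − 𝒜^B_i T̃_i`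
(the source RELATIVE TO THE UNDRESSED step, charge-free at `i = 0` in the same numbers), `CT := 0` — and any other split into `ZfreeSym` sources + a bounded remainder.
The route of record (R-DEV) (the DEVIATION tower `T̃ − T`) is `GAN24/T2DeviationTower`.  Discharges NOTHING of «T2Shape» ∕ «T2Drift» ∕ (hW, hWall); NOT «W-slot
closed», NOT «D1 closed»; NEVER «G-an2-4 closed» as (CONV-C); NOT `BetaPertH`, NOT continuum, NOT Clay.  2026-08-22.
-/

noncomputable section

open Finset
open scoped BigOperators
open Literature.MathematicalPhysics.QuantumFieldTheory
open Literature.MathematicalPhysics.QuantumFieldTheory.Balaban1983to89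
open Literature.MathematicalPhysics.QuantumFieldTheory.Balaban1983to89.Beta
open ExpKernelCalculus (MKer shiftK)
open OneStepResolventKernel (Fib LocStencil)
open OneStepKernelFamily (KInvStep)
open AffineAveraging (box toSite)
open AveragingMixedJetTables (mixFFAt)
open SecondOrderResponse (W2SymOfK)
open BalabanCompositeJets (LocStencil₂ LocStencil₂.nonneg LocStencil₂.mono)
open BalabanStepJetsSucc (mmRead)
open BalabanStepW2 (K3OfK M2Of locStencil₂_smul' locStencil₂_add')
open WilsonBiStencil (wilsonW₂ wBound₂ biLoc_wilsonW₂)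
open Summit.QuantumFields.BalabanUV.Beta.HessKerDressedUnits (unitK unitS)
open Summit.QuantumFields.BalabanUV.Beta.SecondOrderUnits (unitM unitS₂ unitM₂)
open Summit.QuantumFields.BalabanUV.Beta.AxialDressingRooted (coDressKBmAt)
open Summit.QuantumFields.BalabanUV.Beta.SpineRooted (T2RecAt SpureRecAt M1At T2RecAt_zero_level)
open Summit.QuantumFields.BalabanUV.Beta.GAN24.CombesThomas (UnitDecayK sfStep smStep)
open Summit.QuantumFields.BalabanUV.Beta.GAN24.Push4Iter (BiTab)
open Summit.QuantumFields.BalabanUV.Beta.GAN24.T2RecursionAffine (lin4)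
open Summit.QuantumFields.BalabanUV.Beta.GAN24.AffineUnroll (transport)
open Summit.QuantumFields.BalabanUV.Beta.GAN24.BiStencilZeroMode (zmode)
open Summit.QuantumFields.BalabanUV.Beta.GAN24.T2SlotUnits (unitS₂_step_zero)
open Summit.QuantumFields.BalabanUV.Beta.GAN24.TransportRows (transport_rows_three_symZ inv_natCast_nonneg inv_natCast_lt_one)
open Summit.QuantumFields.BalabanUV.Beta.GAN24.WSlotT2OfPieces (shape_of_rows locStencil₂_add)
open Summit.QuantumFields.BalabanUV.Beta.GAN24.T2RecHybridSplit (hyb_hsplit)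

namespace Summit.QuantumFields.BalabanUV.Beta.GAN24.T2HybridShapeEnd

/-! ## §1 (F5) Member 0 of the comb tower -/

section Zero

variable {d : ℕ} {Lc : ℕ} [NeZero Lc]

/-- [folklore] **MEMBER 0 OF THE COMB TOWER IN UNITS IS A `LocStencil₂` FAMILY AT EVERY RATE `0 ≤ δ ≤ δB`** (`unitS₂_0 = id` by `unitS₂_step_zero`; `T2RecAt … 0 =
cE₂ • wilsonW₂ d Tc + cB • vh₂S` by `T2RecAt_zero_level`; an3's `biLoc_wilsonW₂` and the border's own `LocStencil₂` row): constant `|cE₂|·wBound₂·e^{8δ} + |cB|·CB`.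
Generic `d`, any root, any `cE cVH cΛ`, any mixed table. -/
theorem locStencil₂_unitS₂_T2RecAt_zero (ρ : Fin (d + 1) → ℤ) (cE cVH cΛ cE₂ cB : ℝ) (Tc : Fin 4 → Fin 4 → Fin 4 → Fin 4 → ℝ)
    {vh₂S : BiTab d} (mixFF : BiTab d) {CB δB δ : ℝ} (hB : LocStencil₂ vh₂S CB δB) (hδ : 0 ≤ δ) (hδB : δ ≤ δB) :
    LocStencil₂ (unitS₂ (sfStep Lc 0) (smStep d Lc 0) (T2RecAt d Lc ρ cE cVH cΛ cE₂ cB Tc vh₂S mixFF 0))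
      (|cE₂| * (wBound₂ d Tc * Real.exp (8 * δ)) + |cB| * CB) δ := by
  rw [unitS₂_step_zero, T2RecAt_zero_level]
  have hWil : LocStencil₂ (wilsonW₂ d Tc) (wBound₂ d Tc * Real.exp (8 * δ)) δ := fun κ u κ' u' => biLoc_wilsonW₂ Tc hδ κ u κ' u'
  exact locStencil₂_add' (locStencil₂_smul' cE₂ hWil) (locStencil₂_smul' cB (hB.mono hδB))

end Zero

/-! ## §2 The generic `d = 3` socket: «T2Shape» of a split tower from the K-slot, the source rows, member 0 and a contact row -/

section Socket

variable {Lc : ℕ} [NeZero Lc] {CK mK : ℝ}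

/-- NOT IN PRINT; OUR BOOKKEEPING ([folklore]: road W3's END #1 `WSlotT2OfPieces.shape_of_rows (d := 3)` at the hybrid carrier — `hsplit` = p2's `hyb_hsplit`
(definitional), F3a ∧ F3b = `TransportRows.transport_rows_three_symZ` under the pin with `mom := 0` — plus `locStencil₂_add` for the remainder; input rates merged
by `min`).  **THE `d = 3` SOCKET OF HYB-END**: let `T, b, CT : ℕ → BiTab 3` with
`T n = (𝒯^B(0,n) (T 0) + Σ_{i<n} 𝒯^B(i+1,n−1−i) (b i)) + CT n` for road W3's undressed transport of record `𝒯^B`.  If the K-slot holds (`UnitDecayK`, rate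
`mK > 0`), `|cE₂| ≤ Lc^8`, the sources are uniformly `LocStencil₂` (F4a) and `ZfreeSym` (F2), member 0 is `LocStencil₂`, and `CT` is uniformly `LocStencil₂`
((R-CT)), then `∃ C₂ δ₂, 0 < δ₂ ∧ ∀ n, LocStencil₂ (T n) C₂ δ₂`. -/
theorem shape_three_of_hyb_rows (hLc : 2 ≤ Lc) (hK : UnitDecayK 3 Lc (sfStep Lc) (smStep 3 Lc) CK mK) (hmK : 0 < mK) (cE₂ : ℝ)
    (hpin : |cE₂| ≤ (Lc : ℝ) ^ (2 * (3 + 1))) (T b CT : ℕ → BiTab 3) {Cb δb C₀ δ₀ Cct δct : ℝ}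
    (hsplit : ∀ n, T n =
      (transport (fun j => lin4 (cE₂ * (Lc : ℝ) ^ (2 * (3 + 1))) (unitK (sfStep Lc j) (smStep 3 Lc j) (KInvStep (d := 3) Lc j)) Lc) 0 n (T 0) +
        ∑ i ∈ Finset.range n, transport (fun j => lin4 (cE₂ * (Lc : ℝ) ^ (2 * (3 + 1))) (unitK (sfStep Lc j) (smStep 3 Lc j) (KInvStep (d := 3) Lc j)) Lc) (i + 1) (n - 1 - i) (b i)) + CT n)
    (hb : ∀ m, LocStencil₂ (b m) Cb δb) (hδb : 0 < δb)
    (hZ : ∀ m, (∀ κ u κ' u' t, b m κ (u + (Lc : ℤ) • t) κ' (u' + (Lc : ℤ) • t) = shiftK (-((Lc : ℤ) • t)) (b m κ u κ' u')) ∧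
      (∀ κ κ' κ₁ κ₂, zmode Lc (b m) κ κ' (Sum.inl κ₁) (Sum.inl κ₂) + zmode Lc (b m) κ' κ (Sum.inl κ₁) (Sum.inl κ₂) = 0))
    (h0 : LocStencil₂ (T 0) C₀ δ₀) (hδ₀ : 0 < δ₀)
    (hct : ∀ n, LocStencil₂ (CT n) Cct δct) (hδct : 0 < δct) :
    ∃ C₂ δ₂ : ℝ, 0 < δ₂ ∧ ∀ n, LocStencil₂ (T n) C₂ δ₂ := by
  have hLc1 : 1 ≤ Lc := le_trans (by norm_num) hLc
  have hδin : 0 < min δb (min δ₀ δct) := lt_min hδb (lt_min hδ₀ hδct)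
  obtain ⟨CT₁, CT', δT, -, hCT', hδT, hδTin, hTm, hTi⟩ :=
    transport_rows_three_symZ hLc1 hK hmK cE₂ hδin (fun _ => (0 : ℝ))
  have hCb : 0 ≤ Cb := (hb 0).nonneg
  refine ⟨CT₁ * C₀ + CT' * Cb * (1 - ((Lc : ℝ))⁻¹)⁻¹ + Cct, δT, hδT, fun n => ?_⟩
  rw [hsplit n]
  refine locStencil₂_add ?_ ((hct n).mono (hδTin.trans ((min_le_right _ _).trans (min_le_right _ _))))
  have h := shape_of_rows (d := 3)
    (fun n => transport (fun j => lin4 (cE₂ * (Lc : ℝ) ^ (2 * (3 + 1))) (unitK (sfStep Lc j) (smStep 3 Lc j) (KInvStep (d := 3) Lc j)) Lc) 0 n (T 0) +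
      ∑ m ∈ Finset.range n, transport (fun j => lin4 (cE₂ * (Lc : ℝ) ^ (2 * (3 + 1))) (unitK (sfStep Lc j) (smStep 3 Lc j) (KInvStep (d := 3) Lc j)) Lc) (m + 1) (n - 1 - m) (b m))
    b (transport (fun j => lin4 (cE₂ * (Lc : ℝ) ^ (2 * (3 + 1))) (unitK (sfStep Lc j) (smStep 3 Lc j) (KInvStep (d := 3) Lc j)) Lc))
    (fun X : BiTab 3 => (∀ κ u κ' u' t, X κ (u + (Lc : ℤ) • t) κ' (u' + (Lc : ℤ) • t) = shiftK (-((Lc : ℤ) • t)) (X κ u κ' u')) ∧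
      (∀ κ κ' κ₁ κ₂, zmode Lc X κ κ' (Sum.inl κ₁) (Sum.inl κ₂) + zmode Lc X κ' κ (Sum.inl κ₁) (Sum.inl κ₂) = 0))
    (fun _ => (0 : ℝ)) hCT' inv_natCast_nonneg (inv_natCast_lt_one hLc)
    (hyb_hsplit (fun j => lin4 (cE₂ * (Lc : ℝ) ^ (2 * (3 + 1))) (unitK (sfStep Lc j) (smStep 3 Lc j) (KInvStep (d := 3) Lc j)) Lc) (T 0) b)
    (hTm hpin) (hTi hpin) (fun m => ⟨(hb m).mono (min_le_left _ _), hCb⟩) hZ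
    (by simpa using h0.mono ((min_le_right _ _).trans (min_le_left _ _))) n
  simpa using h

end Socket

end Summit.QuantumFields.BalabanUV.Beta.GAN24.T2HybridShapeEnd

end
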